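import Summits.ValiantsHypothesis.ValiantsHypothesis.Theses.ShallowShadows
import Literature.Barriers.ValiantsHypothesis.MonotoneGap
import Summits.ValiantsHypothesis.ValiantsHypothesis.Theorems.CirculantFourierRealFormsRealify

/-!
# Birth skeleton — crux `ShadowFormulaTransfer` (item `stmt-ValiantsHypothesis-17124`), line `birth`

Route `route-ValiantsHypothesis-ShallowShadows`, crux
`Summit.ValiantsHypothesis.ValiantsHypothesis.Theses.ShallowShadows.ShadowFormulaTransfer`
(SHALLOW SHADOWS, degree-calibrated formula form: `∃ δ > 0, C` such that every `0/1`-coefficient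
`VP_ℂ` family `f` has, eventually in `n`, monotone FORMULA size of its shadow
`B(f_n) : a ↦ [∃ m ∈ supp f_n, supp m ⊆ a]` at most `2^((deg f_n)^(1-δ) (log(n+2))^C + C)`).

This is the route's own planned layer-2 split (route header, TWO-LAYER PLAN:
`ShadowFormulaTransfer ⇐ ValiantNormalForm → DominationShallow`, k = 2), typed over the tree's
Jerrum–Snir monotone model `Literature.Barriers.ValiantsHypothesis.IsMonotoneComputation`
(plain fan-in-two circuits over `ℝ≥0`) and the Boolean `formulaSizeOver monotoneBasis`:

* `stub_valiantNormalForm` (VNF — ONE SUBTRACTION AT THE END; known in print, to be formalised,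
  size M/L) — every `VP` family `g` over `ℝ` is, level by level, a difference
  `g n = Q n - R n` of two polynomials with NONNEGATIVE coefficients, each computed by a monotone
  computation, the two of p-bounded total size, with `deg Q n ≤ deg g n`
  (Valiant 1980 §2 Lemma 3 "`P = Q - R` for some monotone `Q` and `R` that can be computed
  simultaneously by a monotone program of complexity `6c`", after Strassen homogenisation to degree
  `deg g n` so that no component above the degree survives; weighted sums `a·u`, `a > 0`, become
  products with the constant operand `a`). [cite: Valiant1980, §2 Lemma 3] [cite: Burgisser2000, §2.1]
* `stub_dominationShallow` (DOMINATION IS SHALLOW — the route's bet, conjecture-grade, the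
  load-bearing stub) — uniform form: there are `δ ∈ (0,1)` and `C` such that for all monotone
  computations `PQ ⊢ Q`, `PR ⊢ R` over `ℝ≥0` with `Q - R` a `0/1` polynomial
  (`Q_m = R_m ∨ Q_m = R_m + 1` for every monomial `m`), the STRICT-DOMINATION up-set
  `a ↦ [∃ m, R_m < Q_m ∧ supp m ⊆ a]` has monotone formula size at most
  `2^((deg Q)^(1-δ) (log(|PQ|+|PR|+2))^C + C)`. A statement inside monotone arithmetic/Boolean
  complexity only (no `VP`, no cancellations except the single final one), consistent with the
  whole 0/1-VP shadow census of the route review (planar/Pfaffian matchings, TU bases, LGV, IMM: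
  `log L = Õ(√deg)`), trivially true when `deg ≤ polylog(size)` (DNF) and when
  `deg ≥ size²` (`≤ 2·size+1` live variables), so only the window `polylog(s) < deg < s²` binds.
  [cite: Valiant1980, §2–3] [cite: arXiv:1406.3065, Lemma 7 (the `R = 0` case: `+ ↦ ∨, × ↦ ∧`)]
  [cite: arXiv:2512.19515, Thm 1.4 and §1.3]
* REAL DESCENT `ℂ → ℝ` is NOT a stub: it is in the tree
  (`Summit.ValiantsHypothesis.ValiantsHypothesis.Theorems.RealForms.exists_realPart_complexity_le`,
  `map_ofRealHom_eq_of_im_eq_zero`: a fan-in-two circuit over `ℂ` of size `s` for a polynomial with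
  real coefficients gives one over `ℝ` of size `6s`), re-packaged here as `realDescent`.
* `ShadowFormulaTransfer_of : Registered.stub_valiantNormalForm →
  Registered.stub_dominationShallow → ShadowFormulaTransfer` — the composition, proved here
  sorry-free: real descent, `supp f_n = {m : R_m < Q_m}` (so the crux's shadow IS the
  strict-domination up-set of the normal form), `deg Q_n ≤ deg f_n`, and the absorption of the
  family's size polynomial into one extra logarithm
  (`(log(s_n+2))^C₀ ≤ (c+2)^C₀ (log(n+2))^C₀ ≤ (log(n+2))^(C₀+1)` once `log(n+2) ≥ (c+2)^C₀`,
  i.e. eventually; crux constants `δ`, `C = C₀ + 1`); the final `example : ShadowFormulaTransfer`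
  wires the sorried stubs into it (the crux closed modulo the stubs).

Disproof used: none (no `Disproof.lean` / `_false_without_` theorem exists for this crux at
registration time; `ledger crux ls stmt-ValiantsHypothesis-17124` = no workfiles). Negatives index
(`ledger negatives --problem ValiantsHypothesis`): nothing on Boolean shadows / monotone formula
size. The hypotheses of `stub_dominationShallow` are load-bearing: the `0/1`-difference hypothesis
is what separates it from the NONNEGATIVE-difference setting of CFM (arXiv:2512.19515), where the
polynomial-size monotone-CIRCUIT analogue is false (Thm 1.4, `P_M = Σ_S det(M[S])² x^S`,
`f_{P_M}` needs `n^{Ω(√log n)}`) and the depth/formula analogue is their open question (§1.3);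
the size `|PQ| + |PR|` of the MONOTONE computations is the only resource in the bound — with the
general complexity of `Q - R` in its place the statement is the crux again (VNF), and with no
resource at all every monotone Boolean function is a strict-domination up-set (`R = 0`,
`Q = Σ_{minterms} x^T`) and Raz–Wigderson's `PM_m` (route support `RazWigdersonMatching`,
`log L = Θ(deg)`) kills it. TRANSFER (why the open stub is easier than the crux): it lives entirely
in monotone arithmetic + monotone Boolean complexity — the data are two monotone circuits and a
sign pattern, so parse-tree / balanced-product structure theorems for monotone circuits
(Valiant1980 §2, Jerrum–Snir) and KW-game depth arguments apply directly, with no general circuit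
and no cancellation left except the single final `Q - R`.
-/

set_option linter.dupNamespace false

noncomputable section

namespace Summit.ValiantsHypothesis.ValiantsHypothesis.Cruxes.ShadowFormulaTransfer.Birth

open Summit.ValiantsHypothesis.ValiantsHypothesis.Theses.ShallowShadows
open Literature.Computability.AlgebraicComplexity Literature.Computability.Complexity
open Literature.Barriers.ValiantsHypothesis (IsMonotoneComputation)
open scoped NNReal Classical

/-- **VNF — VALIANT'S NORMAL FORM, ONE SUBTRACTION AT THE END** (stub statement, named): every
`VP` family over `ℝ` is levelwise `Q - R` with `Q`, `R` over `ℝ≥0` computed by monotone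
computations of p-bounded total size and `deg Q n ≤ deg g n`.
[known, to be formalised: Valiant1980 §2 Lemma 3 + Strassen homogenisation; Burgisser2000 §2.1] -/
def ValiantNormalForm : Prop :=
  ∀ (σ : ℕ → Type) [∀ n, Fintype (σ n)] (g : ∀ n, MvPolynomial (σ n) ℝ),
    IsVPFamily g →
    ∃ (Q R : ∀ n, MvPolynomial (σ n) ℝ≥0) (PQ PR : ∀ n, ArithCircuit ℝ≥0 (σ n)),
      (∀ n, IsMonotoneComputation (PQ n) (Q n)) ∧ (∀ n, IsMonotoneComputation (PR n) (R n)) ∧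
      IsPBounded (fun n => (PQ n).size + (PR n).size) ∧
      (∀ n, (Q n).totalDegree ≤ (g n).totalDegree) ∧
      ∀ n, g n = MvPolynomial.map NNReal.toRealHom (Q n) - MvPolynomial.map NNReal.toRealHom (R n)

/-- **DOMINATION IS SHALLOW** (stub statement, named; the route's bet): uniformly in the instance,
the strict-domination up-set of a monotone-cheap pair `R ≤ Q` with `0/1` difference has monotone
formulas of size `2^((deg Q)^(1-δ) (log(|PQ|+|PR|+2))^C + C)`.
[conjecture-grade: Valiant1980; arXiv:1406.3065 Lemma 7; arXiv:2512.19515 Thm 1.4, §1.3;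
RazWigderson1992 (the far side)] -/
def DominationShallow : Prop :=
  ∃ δ : ℝ, 0 < δ ∧ δ < 1 ∧ ∃ C : ℕ, ∀ (ι : Type) [Fintype ι] (Q R : MvPolynomial ι ℝ≥0)
    (PQ PR : ArithCircuit ℝ≥0 ι), IsMonotoneComputation PQ Q → IsMonotoneComputation PR R →
    (∀ m : ι →₀ ℕ, Q.coeff m = R.coeff m ∨ Q.coeff m = R.coeff m + 1) →
    (formulaSizeOver monotoneBasis (fun a : ι → Bool =>
        decide (∃ m : ι →₀ ℕ, R.coeff m < Q.coeff m ∧ ∀ i ∈ m.support, a i = true)) : ℝ)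
      ≤ 2 ^ ((Q.totalDegree : ℝ) ^ (1 - δ) * (Real.log (((PQ.size + PR.size : ℕ) : ℝ) + 2)) ^ C + C)

/-- Stub VNF (registered obligation; signature = `ValiantNormalForm` verbatim).
[known, to be formalised: Valiant1980 §2 Lemma 3; Burgisser2000 §2.1] -/
theorem stub_valiantNormalForm :
    ∀ (σ : ℕ → Type) [∀ n, Fintype (σ n)] (g : ∀ n, MvPolynomial (σ n) ℝ),
      IsVPFamily g →
      ∃ (Q R : ∀ n, MvPolynomial (σ n) ℝ≥0) (PQ PR : ∀ n, ArithCircuit ℝ≥0 (σ n)),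
        (∀ n, IsMonotoneComputation (PQ n) (Q n)) ∧ (∀ n, IsMonotoneComputation (PR n) (R n)) ∧
        IsPBounded (fun n => (PQ n).size + (PR n).size) ∧
        (∀ n, (Q n).totalDegree ≤ (g n).totalDegree) ∧
        ∀ n, g n = MvPolynomial.map NNReal.toRealHom (Q n) -
          MvPolynomial.map NNReal.toRealHom (R n) := by
  sorry

/-- Stub DominationShallow (registered obligation; signature = `DominationShallow` verbatim).
[conjecture-grade: Valiant1980; arXiv:1406.3065; arXiv:2512.19515; RazWigderson1992] -/
theorem stub_dominationShallow :
    ∃ δ : ℝ, 0 < δ ∧ δ < 1 ∧ ∃ C : ℕ, ∀ (ι : Type) [Fintype ι] (Q R : MvPolynomial ι ℝ≥0)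
      (PQ PR : ArithCircuit ℝ≥0 ι), IsMonotoneComputation PQ Q → IsMonotoneComputation PR R →
      (∀ m : ι →₀ ℕ, Q.coeff m = R.coeff m ∨ Q.coeff m = R.coeff m + 1) →
      (formulaSizeOver monotoneBasis (fun a : ι → Bool =>
          decide (∃ m : ι →₀ ℕ, R.coeff m < Q.coeff m ∧ ∀ i ∈ m.support, a i = true)) : ℝ)
        ≤ 2 ^ ((Q.totalDegree : ℝ) ^ (1 - δ) *
            (Real.log (((PQ.size + PR.size : ℕ) : ℝ) + 2)) ^ C + C) := by
  sorry

/-! ## Name-keyed aliases of the two stub statements (hypotheses of the composition)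

`Registered.stub_X` is the statement of `stub_X` under the registered stub's short name, so that the
native skeleton audit (`#h21_check_skeleton`: hypotheses admissible iff registered obligations /
declared stubs BY NAME) accepts `ShadowFormulaTransfer_of : Registered.stub_… → Registered.stub_… →
ShadowFormulaTransfer` (device of `Cruxes/RestorationQP/Lines/birth.lean`). -/
namespace Registered

/-- Alias of `ValiantNormalForm` (= the signature of `stub_valiantNormalForm`). -/
abbrev stub_valiantNormalForm : Prop := ValiantNormalForm
/-- Alias of `DominationShallow` (= the signature of `stub_dominationShallow`). -/
abbrev stub_dominationShallow : Prop := DominationShallow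

end Registered

/-- REAL DESCENT (in-tree, `Theorems/CirculantFourierRealFormsRealify`): a `VP_ℂ` family all of
whose coefficients are real is the complexification of a `VP_ℝ` family. [folklore; Burgisser2000 §4.1] -/
theorem realDescent (σ : ℕ → Type) [∀ n, Fintype (σ n)] (f : ∀ n, MvPolynomial (σ n) ℂ)
    (hf : IsVPFamily f) (him : ∀ n m, ((f n).coeff m).im = 0) :
    ∃ g : ∀ n, MvPolynomial (σ n) ℝ, IsVPFamily g ∧
      ∀ n, MvPolynomial.map Complex.ofRealHom (g n) = f n := by
  choose x y hxy hcx using fun n =>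
    Summit.ValiantsHypothesis.ValiantsHypothesis.Theorems.RealForms.exists_realPart_complexity_le
      (f n)
  have hmap : ∀ n, MvPolynomial.map Complex.ofRealHom (x n) = f n := fun n =>
    Summit.ValiantsHypothesis.ValiantsHypothesis.Theorems.RealForms.map_ofRealHom_eq_of_im_eq_zero
      (hxy n) (him n)
  refine ⟨x, ?_, hmap⟩
  obtain ⟨⟨hcard, hdeg⟩, hcomp⟩ := hf
  refine ⟨⟨hcard, hdeg.mono fun n => le_of_eq ?_⟩, ?_⟩
  · rw [← hmap n, MvPolynomial.totalDegree, MvPolynomial.totalDegree,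
      MvPolynomial.support_map_of_injective _ Complex.ofRealHom.injective]
  · exact (IsPBounded.mul_holds (IsPBounded.const 6) hcomp).mono fun n => hcx n

/-- Total degree is invariant under complexification. [folklore] -/
theorem totalDegree_map_ofRealHom {ι : Type*} (p : MvPolynomial ι ℝ) :
    (MvPolynomial.map Complex.ofRealHom p).totalDegree = p.totalDegree := by
  rw [MvPolynomial.totalDegree, MvPolynomial.totalDegree,
    MvPolynomial.support_map_of_injective _ Complex.ofRealHom.injective]

/-- Size absorption, natural-number part: `n^c + c + 2 ≤ (n+2)^(c+2)`. [folklore] -/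
theorem pow_add_le_pow (n c : ℕ) : n ^ c + c + 2 ≤ (n + 2) ^ (c + 2) := by
  have h1 : n ^ c ≤ (n + 2) ^ c := Nat.pow_le_pow_left (by omega) c
  have h2 : c < 2 ^ c := c.lt_two_pow_self
  have h3 : 2 ^ c ≤ (n + 2) ^ c := Nat.pow_le_pow_left (by omega) c
  have h4 : 2 ^ 2 ≤ (n + 2) ^ 2 := Nat.pow_le_pow_left (by omega) 2
  have key : (n + 2) ^ c * 4 ≤ (n + 2) ^ (c + 2) := by
    rw [pow_add]
    exact Nat.mul_le_mul_left _ (by simpa using h4)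
  omega

/-- **Composition** (the glue of the line, kernel-checked): real descent (in tree), Valiant's
normal form (VNF) and DominationShallow give the crux with constants `δ`, `C₀ + 1`: the shadow of
`f_n = Q_n - R_n` is the strict-domination up-set of `(Q_n, R_n)`, `deg Q_n ≤ deg f_n`, and the
family's size polynomial is absorbed by one extra logarithm eventually. [folklore] -/
theorem ShadowFormulaTransfer_of :
    Registered.stub_valiantNormalForm → Registered.stub_dominationShallow →
      ShadowFormulaTransfer := by
  intro hVNF hDS
  obtain ⟨δ, hδ0, hδ1, C₀, hC⟩ := hDS
  refine ⟨δ, hδ0, C₀ + 1, ?_⟩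
  intro σ _ _ f hVP h01
  -- real descent and Valiant's normal form
  have him : ∀ n m, ((f n).coeff m).im = 0 := by
    intro n m
    rcases h01 n m with h | h <;> simp [h]
  obtain ⟨g, hgVP, hgf⟩ := realDescent σ f hVP him
  obtain ⟨Q, R, PQ, PR, hPQ, hPR, ⟨c, hc⟩, hdeg, hgQR⟩ := hVNF σ g hgVP
  -- the threshold: log (n + 2) ≥ (c + 2) ^ C₀
  refine ⟨⌈Real.exp (((c : ℝ) + 2) ^ C₀)⌉₊, fun n hn => ?_⟩
  -- coefficient bookkeeping at level n
  have hcoeff : ∀ m, (f n).coeff m =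
      ((↑((Q n).coeff m) : ℝ) : ℂ) - ((↑((R n).coeff m) : ℝ) : ℂ) := by
    intro m
    rw [← hgf n, hgQR n]
    simp [MvPolynomial.coeff_map]
  have hdich : ∀ m, (Q n).coeff m = (R n).coeff m ∨ (Q n).coeff m = (R n).coeff m + 1 := by
    intro m
    rcases h01 n m with h | h
    · left
      rw [hcoeff m, sub_eq_zero] at h
      exact_mod_cast h
    · right
      rw [hcoeff m] at h
      have h' : (↑((Q n).coeff m) : ℝ) - (↑((R n).coeff m) : ℝ) = 1 := by exact_mod_cast h
      have h'' : (↑((Q n).coeff m) : ℝ) = (↑((R n).coeff m) : ℝ) + 1 := by linarith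
      exact_mod_cast h''
  have hsupp : ∀ m, m ∈ (f n).support ↔ (R n).coeff m < (Q n).coeff m := by
    intro m
    rw [MvPolynomial.mem_support_iff, hcoeff m, sub_ne_zero]
    constructor
    · intro hne
      rcases hdich m with h | h
      · exact absurd (by rw [h]) hne
      · rw [h]; exact lt_add_one _
    · intro hlt
      have hne : (↑((Q n).coeff m) : ℝ) ≠ (↑((R n).coeff m) : ℝ) := by
        exact_mod_cast (ne_of_gt hlt)
      exact_mod_cast hne
  -- DominationShallow at level n, then the exponent comparison
  have hB := hC (σ n) (Q n) (R n) (PQ n) (PR n) (hPQ n) (hPR n) hdich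
  set s : ℕ := (PQ n).size + (PR n).size with hs
  have hsn : s ≤ n ^ c + c := hc n
  have hsNat : s + 2 ≤ (n + 2) ^ (c + 2) := (Nat.add_le_add_right hsn 2).trans (by
    have := pow_add_le_pow n c; omega)
  have hsR : ((s : ℝ) + 2) ≤ ((n : ℝ) + 2) ^ (c + 2) := by exact_mod_cast hsNat
  have hLn_ge : ((c : ℝ) + 2) ^ C₀ ≤ Real.log ((n : ℝ) + 2) := by
    rw [Real.le_log_iff_exp_le (by positivity)]
    have h1 : Real.exp (((c : ℝ) + 2) ^ C₀) ≤ ⌈Real.exp (((c : ℝ) + 2) ^ C₀)⌉₊ := Nat.le_ceil _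
    have h2 : (⌈Real.exp (((c : ℝ) + 2) ^ C₀)⌉₊ : ℝ) ≤ n := by exact_mod_cast hn
    linarith
  have hA1 : (1 : ℝ) ≤ ((c : ℝ) + 2) ^ C₀ := one_le_pow₀ (by linarith)
  have hLn_pos : 0 < Real.log ((n : ℝ) + 2) := by linarith
  have hLs0 : 0 ≤ Real.log ((s : ℝ) + 2) := Real.log_nonneg (by linarith)
  have hLs : Real.log ((s : ℝ) + 2) ≤ ((c : ℝ) + 2) * Real.log ((n : ℝ) + 2) := by
    calc Real.log ((s : ℝ) + 2) ≤ Real.log (((n : ℝ) + 2) ^ (c + 2)) :=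
          Real.log_le_log (by positivity) hsR
      _ = ((c + 2 : ℕ) : ℝ) * Real.log ((n : ℝ) + 2) := by rw [Real.log_pow]
      _ = ((c : ℝ) + 2) * Real.log ((n : ℝ) + 2) := by push_cast; ring
  have hpowC : Real.log ((s : ℝ) + 2) ^ C₀ ≤ Real.log ((n : ℝ) + 2) ^ (C₀ + 1) := by
    calc Real.log ((s : ℝ) + 2) ^ C₀ ≤ (((c : ℝ) + 2) * Real.log ((n : ℝ) + 2)) ^ C₀ :=
          pow_le_pow_left₀ hLs0 hLs C₀
      _ = ((c : ℝ) + 2) ^ C₀ * Real.log ((n : ℝ) + 2) ^ C₀ := by rw [mul_pow]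
      _ ≤ Real.log ((n : ℝ) + 2) * Real.log ((n : ℝ) + 2) ^ C₀ :=
          mul_le_mul_of_nonneg_right hLn_ge (pow_nonneg hLn_pos.le C₀)
      _ = Real.log ((n : ℝ) + 2) ^ (C₀ + 1) := by rw [pow_succ']
  have hdegQf : ((Q n).totalDegree : ℝ) ≤ ((f n).totalDegree : ℝ) := by
    have : (Q n).totalDegree ≤ (f n).totalDegree := by
      rw [← hgf n, totalDegree_map_ofRealHom]; exact hdeg n
    exact_mod_cast this
  have hrpow : ((Q n).totalDegree : ℝ) ^ (1 - δ) ≤ ((f n).totalDegree : ℝ) ^ (1 - δ) :=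
    Real.rpow_le_rpow (by positivity) hdegQf (by linarith)
  have hexp : ((Q n).totalDegree : ℝ) ^ (1 - δ) * Real.log ((s : ℝ) + 2) ^ C₀ + (C₀ : ℝ) ≤
      ((f n).totalDegree : ℝ) ^ (1 - δ) * Real.log ((n : ℝ) + 2) ^ (C₀ + 1) +
        ((C₀ + 1 : ℕ) : ℝ) := by
    have hm := mul_le_mul hrpow hpowC (pow_nonneg hLs0 C₀)
      (Real.rpow_nonneg (by positivity) _)
    push_cast
    linarith
  have hB' := hB.trans (Real.rpow_le_rpow_of_exponent_le (by norm_num : (1 : ℝ) ≤ 2) hexp)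
  refine le_trans (le_of_eq ?_) hB'
  congr 1
  congr 1
  funext a
  refine decide_eq_decide.mpr ⟨?_, ?_⟩
  · rintro ⟨m, hm, ha⟩
    exact ⟨m, (hsupp m).mp hm, ha⟩
  · rintro ⟨m, hm, ha⟩
    exact ⟨m, (hsupp m).mpr hm, ha⟩

/-- Wiring check: the registered stubs feed `ShadowFormulaTransfer_of` exactly as stated, so the
skeleton is `ShadowFormulaTransfer` closed modulo the two stubs (sorries enter only through them). -/
example : ShadowFormulaTransfer :=
  ShadowFormulaTransfer_of stub_valiantNormalForm stub_dominationShallow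

end Summit.ValiantsHypothesis.ValiantsHypothesis.Cruxes.ShadowFormulaTransfer.Birth

end
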